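import Summits.Ventures.PercRepro.ProfilePointedCircuitClassesTwelveSeriesC

/-!
# PercRepro — THE DOUBLE SERIES PAIR REGIME OF THE TWELVE-POINT STATEMENT REDUCES TO THE NINE-POINT TWO-POINT
INEQUALITY (★)₉ (p5, gen 51; `proofs/P5-GM1.md` §77)

(★) at `(n, ρ) = (11, 6)` — `in_5(e) ≤ in_5(f) + thru_5({e, f})` — is the refuted eleven-point inequality of §66
(false on the pencil family, §66 ADD 3).  Its nine-point sibling **(★)₉** at `(9, 5)`, `in_4(e) ≤ in_4(f) + thru_4({e, f})`
on coloop-free matroids, is EXHAUSTIVELY TRUE on the engine's complete catalogue of the 383,172 matroids on nine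
elements (189,010 coloop-free rank-`5` matroids with a bi-independent `4`-set, 13,608,720 ordered pairs, 0 violations,
§77) — here the Prop `StarNine` (a CONJECTURE def, NOT asserted; it is carried as a hypothesis).

THE REDUCTION.  On `#E = 11`, `ρ(E) = 6` with a series pair `{b, b'}` and a point `f` with `ρ{f, b, b'} = 2`
(`{f, b, b'}` a triangle), (★) at `(e, f)` follows from (★)₉ at `(e, f)` on the minor `N ／ b ∖ b'`
(`star_of_seriesPair_of_triangle_of_star_minor`): no bi-independent `5`-set contains both `b, b'`; a set avoiding
both is a basis-complement containing the triangle unless it contains `f`, so the sets through `e` avoiding `b, b'`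
all contain `f` and are counted by `thru_5({e, f})`; the sets through `b` (resp. `b'`) are the traces of the
bi-independent `4`-sets of the minor (`card_filter_minor_insert_left_eq_of_seriesPair`), equal in number by the swap —
hence `in_5(e) = 2·in_4^{N₉}(e) + γ`, `thru_5({e, f}) ≥ 2·thru_4^{N₉}({e, f}) + γ`, `in_5(f) ≥ 2·in_4^{N₉}(f)`.
THE REGIME.  On `#E = 12`, `ρ(E) = 7`, with TWO series pairs `{a, a'}`, `{b, b'}` on a common `4`-circuit
(`ρ{a, a', b, b'} = 3`) and `e` outside: in `N ／ a` the pair `{b, b'}` survives and `{a', b, b'}` is a triangle, so (★)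
at `(e, a')` on `N ／ a` — which gives `in_5(e) ≤ out_6(e)` by §66's `inCount_five_le_outCount_six_of_seriesPair_of_star`
— follows from (★)₉ on `N ／ {a, b} ∖ b'`: **`inCount_five_le_outCount_six_of_two_seriesPairs_of_star_nine`**, and
**`…_of_starNine`** under the Prop.  This regime carries 125 of the 930 residual hits of kit j325084 (§76 ADD 1(d)).
-/

open scoped Matroid

namespace PercRepro.Cogirth

open Finset ThmH Skew Shadow Profile

variable {α : Type} [DecidableEq α] {N : Matroid α} [N.Finite]

section StarNine

/-- **THE NINE-POINT TWO-POINT INEQUALITY (★)₉** (a CONJECTURE `Prop`, NOT asserted): on every coloop-free matroid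
with `#E = 9`, `ρ(E) = 5` and all `e ≠ f`, `in_4(e) ≤ in_4(f) + thru_4({e, f})`.  Exhaustively true on the complete
catalogue of nine-element matroids (§77). -/
def StarNine (α : Type) [DecidableEq α] : Prop :=
  ∀ (N : Matroid α) [N.Finite], (gr N).card = 9 → rk N (gr N) = 5 →
    (∀ x ∈ gr N, rk N ((gr N).erase x) = 5) →
    ∀ e ∈ gr N, ∀ f ∈ gr N, e ≠ f → inCount N 4 e ≤ inCount N 4 f + thruCount N 4 {e, f}

/-- A series pair survives the contraction of a third point. -/
theorem seriesPair_contract_of_ne {a b b' : α} (h : SeriesPair N b b') (ha : a ∈ gr N) (hab : a ≠ b)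
    (hab' : a ≠ b') (hind : N.Indep ({a} : Set α)) : SeriesPair (N ／ ({a} : Set α)) b b' := by
  obtain ⟨hb, hb', hbb', hcb, hcb', hser⟩ := h
  have hgr : gr (N ／ ({a} : Set α)) = (gr N).erase a := gr_contract'
  have hE := rk_gr_contract_add_one hind ha
  rw [hgr] at hE
  unfold SeriesPair
  rw [hgr]
  have h1 := rk_contract_add_one hind (X := ((gr N).erase a).erase b) (erase_subset _ _)
  have h2 := rk_contract_add_one hind (X := ((gr N).erase a).erase b') (erase_subset _ _)
  have h3 := rk_contract_add_one hind (X := (((gr N).erase a).erase b).erase b')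
    ((erase_subset _ _).trans (erase_subset _ _))
  have e1 : insert a (((gr N).erase a).erase b) = (gr N).erase b := by
    rw [erase_right_comm, insert_erase (mem_erase.2 ⟨hab, ha⟩)]
  have e2 : insert a (((gr N).erase a).erase b') = (gr N).erase b' := by
    rw [erase_right_comm, insert_erase (mem_erase.2 ⟨hab', ha⟩)]
  have e3 : insert a ((((gr N).erase a).erase b).erase b') = ((gr N).erase b).erase b' := by
    have : (((gr N).erase a).erase b).erase b' = (((gr N).erase b).erase b').erase a := by
      ext x
      simp only [mem_erase]
      tauto
    rw [this, insert_erase (mem_erase.2 ⟨hab', mem_erase.2 ⟨hab, ha⟩⟩)]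
  rw [e1, hcb] at h1
  rw [e2, hcb'] at h2
  rw [e3] at h3
  refine ⟨mem_erase.2 ⟨hab.symm, hb⟩, mem_erase.2 ⟨hab'.symm, hb'⟩, hbb', ?_, ?_, ?_⟩ <;> omega

/-- **(★) ON ELEVEN POINTS FROM (★)₉ ON THE MINOR**: on `#E = 11`, `ρ(E) = 6`, let `{b, b'}` be a series pair and
`f` a point with `ρ{f, b, b'} = 2`, `e ∉ {b, b', f}`.  If (★)₉ holds at `(e, f)` on `N ／ b ∖ b'`, then (★) holds at
`(e, f)` on `N`: `in_5(e) ≤ in_5(f) + thru_5({e, f})`. -/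
theorem star_of_seriesPair_of_triangle_of_star_minor (hn : (gr N).card = 11) (hR : rk N (gr N) = 6)
    {b b' e f : α} (h : SeriesPair N b b') (hf : f ∈ gr N) (hef : e ≠ f) (heb : e ≠ b)
    (heb' : e ≠ b') (hfb : f ≠ b) (hfb' : f ≠ b') (htri : rk N {f, b, b'} = 2)
    (h9 : inCount ((N ／ ({b} : Set α)) ＼ ({b'} : Set α)) 4 e ≤
      inCount ((N ／ ({b} : Set α)) ＼ ({b'} : Set α)) 4 f +
        thruCount ((N ／ ({b} : Set α)) ＼ ({b'} : Set α)) 4 {e, f}) :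
    inCount N 5 e ≤ inCount N 5 f + thruCount N 5 {e, f} := by
  have hb : b ∈ gr N := h.1
  have hb' : b' ∈ gr N := h.2.1
  have hbb' : b ≠ b' := h.2.2.1
  have hn5 : (gr N).card = rk N (gr N) + 5 := by omega
  -- the transfer predicates
  have hIe : ∀ Y : Finset α, e ∈ insert b Y ↔ e ∈ Y := by
    intro Y
    rw [mem_insert]
    exact ⟨fun h' => h'.resolve_left heb, fun h' => Or.inr h'⟩
  have hIf : ∀ Y : Finset α, f ∈ insert b Y ↔ f ∈ Y := by
    intro Y
    rw [mem_insert]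
    exact ⟨fun h' => h'.resolve_left hfb, fun h' => Or.inr h'⟩
  have hIef : ∀ Y : Finset α, ({e, f} : Finset α) ⊆ insert b Y ↔ ({e, f} : Finset α) ⊆ Y := by
    intro Y
    constructor
    · intro h' x hx
      have h1 := h' hx
      rw [mem_insert] at h1
      rcases h1 with h1 | h1
      · rw [mem_insert, mem_singleton] at hx
        rcases hx with hx | hx
        · exact absurd (hx ▸ h1) heb
        · exact absurd (hx ▸ h1) hfb
      · exact h1
    · intro h' x hx
      exact mem_insert_of_mem (h' hx)
  -- the swap predicates
  have hPe : ∀ W : Finset α, e ∈ insert b' (W.erase b) ↔ e ∈ W := by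
    intro W
    rw [mem_insert, mem_erase]
    constructor
    · rintro (h' | ⟨_, h'⟩)
      · exact absurd h' heb'
      · exact h'
    · intro h'
      exact Or.inr ⟨heb, h'⟩
  have hPe' : ∀ W : Finset α, e ∈ insert b (W.erase b') ↔ e ∈ W := by
    intro W
    rw [mem_insert, mem_erase]
    constructor
    · rintro (h' | ⟨_, h'⟩)
      · exact absurd h' heb
      · exact h'
    · intro h'
      exact Or.inr ⟨heb', h'⟩
  have hPf : ∀ W : Finset α, f ∈ insert b' (W.erase b) ↔ f ∈ W := by
    intro W
    rw [mem_insert, mem_erase]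
    constructor
    · rintro (h' | ⟨_, h'⟩)
      · exact absurd h' hfb'
      · exact h'
    · intro h'
      exact Or.inr ⟨hfb, h'⟩
  have hPf' : ∀ W : Finset α, f ∈ insert b (W.erase b') ↔ f ∈ W := by
    intro W
    rw [mem_insert, mem_erase]
    constructor
    · rintro (h' | ⟨_, h'⟩)
      · exact absurd h' hfb
      · exact h'
    · intro h'
      exact Or.inr ⟨hfb', h'⟩
  have hPef : ∀ W : Finset α, ({e, f} : Finset α) ⊆ insert b' (W.erase b) ↔ ({e, f} : Finset α) ⊆ W := by
    intro W
    rw [insert_subset_iff, insert_subset_iff, singleton_subset_iff, singleton_subset_iff, hPe, hPf]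
  have hPef' : ∀ W : Finset α, ({e, f} : Finset α) ⊆ insert b (W.erase b') ↔ ({e, f} : Finset α) ⊆ W := by
    intro W
    rw [insert_subset_iff, insert_subset_iff, singleton_subset_iff, singleton_subset_iff, hPe', hPf']
  -- the four-cell splits
  have hSe := card_filter_eq_sum_four (biIndepSets N 5) (fun W => e ∈ W) b b'
  have hSf := card_filter_eq_sum_four (biIndepSets N 5) (fun W => f ∈ W) b b'
  have hSef := card_filter_eq_sum_four (biIndepSets N 5) (fun W => ({e, f} : Finset α) ⊆ W) b b'
  -- no set contains both `b, b'`
  have hboth : ∀ P : Finset α → Prop, [DecidablePred P] →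
      ((biIndepSets N 5).filter (fun W => (P W ∧ b ∈ W) ∧ b' ∈ W)).card = 0 := by
    intro P _
    rw [card_eq_zero, filter_eq_empty_iff]
    intro W hW hc
    exact not_mem_of_mem_biIndepSets_of_seriesPair h hn5 hW hc.1.2 hc.2
  -- the swaps
  have hSwe := card_filter_swap_of_seriesPair h 5 (fun W => e ∈ W) hPe hPe'
  have hSwf := card_filter_swap_of_seriesPair h 5 (fun W => f ∈ W) hPf hPf'
  have hSwef := card_filter_swap_of_seriesPair h 5 (fun W => ({e, f} : Finset α) ⊆ W) hPef hPef'
  -- the transfers to the minor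
  have hTe := card_filter_minor_insert_left_eq_of_seriesPair h 4 (fun Y => e ∈ Y) hIe
  have hTf := card_filter_minor_insert_left_eq_of_seriesPair h 4 (fun Y => f ∈ Y) hIf
  have hTef := card_filter_minor_insert_left_eq_of_seriesPair h 4 (fun Y => ({e, f} : Finset α) ⊆ Y) hIef
  simp only [Nat.reduceAdd] at hTe hTf hTef
  -- the sets through `e` avoiding `b, b'` contain `f`
  have hγ : ((biIndepSets N 5).filter (fun W => (e ∈ W ∧ b ∉ W) ∧ b' ∉ W)).card ≤
      ((biIndepSets N 5).filter (fun W => (({e, f} : Finset α) ⊆ W ∧ b ∉ W) ∧ b' ∉ W)).card := by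
    apply card_le_card
    intro W hW
    rw [mem_filter] at hW ⊢
    obtain ⟨hWb, ⟨heW, hbW⟩, hb'W⟩ := hW
    refine ⟨hWb, ⟨?_, hbW⟩, hb'W⟩
    by_contra hfW
    rw [insert_subset_iff, singleton_subset_iff, not_and] at hfW
    have hfW' : f ∉ W := hfW heW
    obtain ⟨hWg, hWc, hWr, hWcompl⟩ := mem_biIndepSets.1 hWb
    have hsub : ({f, b, b'} : Finset α) ⊆ gr N \ W := by
      intro x hx
      rw [mem_insert, mem_insert, mem_singleton] at hx
      rcases hx with rfl | rfl | rfl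
      · exact mem_sdiff.2 ⟨hf, hfW'⟩
      · exact mem_sdiff.2 ⟨hb, hbW⟩
      · exact mem_sdiff.2 ⟨hb', hb'W⟩
    have h3 := rk_eq_card_of_subset_of_rk_eq_card hsub hWcompl
    rw [htri, card_insert_of_notMem, card_insert_of_notMem (notMem_singleton.2 hbb'), card_singleton] at h3
    · omega
    · rw [mem_insert, mem_singleton]
      rintro (h' | h')
      · exact hfb h'
      · exact hfb' h'
  -- the filter `{e, f} ⊆ W ∧ …` sits inside `thru_5({e, f})`
  unfold inCount thruCount at *
  have hsub1 : ((biIndepSets N 5).filter (fun W => (({e, f} : Finset α) ⊆ W ∧ b ∉ W) ∧ b' ∉ W)).card +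
      ((biIndepSets N 5).filter (fun W => (({e, f} : Finset α) ⊆ W ∧ b ∈ W) ∧ b' ∉ W)).card +
      ((biIndepSets N 5).filter (fun W => (({e, f} : Finset α) ⊆ W ∧ b ∉ W) ∧ b' ∈ W)).card ≤
      ((biIndepSets N 5).filter (fun W => ({e, f} : Finset α) ⊆ W)).card := by
    have := hboth (fun W => ({e, f} : Finset α) ⊆ W)
    omega
  have hsub2 : ((biIndepSets N 5).filter (fun W => (f ∈ W ∧ b ∈ W) ∧ b' ∉ W)).card +
      ((biIndepSets N 5).filter (fun W => (f ∈ W ∧ b ∉ W) ∧ b' ∈ W)).card ≤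
      ((biIndepSets N 5).filter (fun W => f ∈ W)).card := by
    have := hboth (fun W => f ∈ W)
    omega
  have hze := hboth (fun W => e ∈ W)
  omega

/-- **THE DOUBLE SERIES PAIR REGIME, MODULO (★)₉**: on `#E = 12`, `ρ(E) = 7`, with series pairs `{a, a'}` and
`{b, b'}` on a common `4`-circuit (`ρ{a, a', b, b'} = 3`) and `e ∉ {a, a', b, b'}`, if (★)₉ holds at `(e, a')` on the
minor `N ／ {a, b} ∖ b'` then `in_5(e) ≤ out_6(e)`. -/
theorem inCount_five_le_outCount_six_of_two_seriesPairs_of_star_nine (hn : (gr N).card = 12)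
    (hR : rk N (gr N) = 7) {a a' b b' e : α} (h : SeriesPair N a a') (h' : SeriesPair N b b') (hab : a ≠ b)
    (hab' : a ≠ b') (ha'b : a' ≠ b) (ha'b' : a' ≠ b') (hcirc : rk N {a, a', b, b'} = 3) (he : e ∈ gr N)
    (hea : e ≠ a) (hea' : e ≠ a') (heb : e ≠ b) (heb' : e ≠ b')
    (h9 : inCount (((N ／ ({a} : Set α)) ／ ({b} : Set α)) ＼ ({b'} : Set α)) 4 e ≤
      inCount (((N ／ ({a} : Set α)) ／ ({b} : Set α)) ＼ ({b'} : Set α)) 4 a' +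
        thruCount (((N ／ ({a} : Set α)) ／ ({b} : Set α)) ＼ ({b'} : Set α)) 4 {e, a'}) :
    inCount N 5 e ≤ outCount N 6 e := by
  have ha : a ∈ gr N := h.1
  have ha' : a' ∈ gr N := h.2.1
  have haa' : a ≠ a' := h.2.2.1
  have hind := indep_singleton_of_seriesPair h
  have hgr : gr (N ／ ({a} : Set α)) = (gr N).erase a := gr_contract'
  have hn' : (gr (N ／ ({a} : Set α))).card = 11 := by
    rw [hgr, card_erase_of_mem ha, hn]
  have hR' : rk (N ／ ({a} : Set α)) (gr (N ／ ({a} : Set α))) = 6 := by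
    have := rk_gr_contract_add_one hind ha
    omega
  have hser' : SeriesPair (N ／ ({a} : Set α)) b b' := seriesPair_contract_of_ne h' ha hab hab' hind
  have htri : rk (N ／ ({a} : Set α)) {a', b, b'} = 2 := by
    have hX : ({a', b, b'} : Finset α) ⊆ (gr N).erase a := by
      intro x hx
      rw [mem_insert, mem_insert, mem_singleton] at hx
      rcases hx with rfl | rfl | rfl
      · exact mem_erase.2 ⟨haa'.symm, ha'⟩
      · exact mem_erase.2 ⟨hab.symm, h'.1⟩
      · exact mem_erase.2 ⟨hab'.symm, h'.2.1⟩
    have := rk_contract_add_one hind hX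
    rw [hcirc] at this
    omega
  have ha'' : a' ∈ gr (N ／ ({a} : Set α)) := by rw [hgr]; exact mem_erase.2 ⟨haa'.symm, ha'⟩
  have hstar := star_of_seriesPair_of_triangle_of_star_minor hn' hR' hser' ha'' hea' heb heb' ha'b ha'b'
    htri h9
  exact inCount_five_le_outCount_six_of_seriesPair_of_star hn hR h he hea hea' hstar

/-- **THE DOUBLE SERIES PAIR REGIME UNDER `StarNine`**: the hypothesis of
`inCount_five_le_outCount_six_of_two_seriesPairs_of_star_nine` discharged from the Prop, given that the minor
`N ／ {a, b} ∖ b'` is coloop-free. -/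
theorem inCount_five_le_outCount_six_of_two_seriesPairs_of_starNine (hS : StarNine α) (hn : (gr N).card = 12)
    (hR : rk N (gr N) = 7) {a a' b b' e : α} (h : SeriesPair N a a') (h' : SeriesPair N b b') (hab : a ≠ b)
    (hab' : a ≠ b') (ha'b : a' ≠ b) (ha'b' : a' ≠ b') (hcirc : rk N {a, a', b, b'} = 3) (he : e ∈ gr N)
    (hea : e ≠ a) (hea' : e ≠ a') (heb : e ≠ b) (heb' : e ≠ b')
    (hcf9 : ∀ z ∈ gr (((N ／ ({a} : Set α)) ／ ({b} : Set α)) ＼ ({b'} : Set α)),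
      rk (((N ／ ({a} : Set α)) ／ ({b} : Set α)) ＼ ({b'} : Set α))
        ((gr (((N ／ ({a} : Set α)) ／ ({b} : Set α)) ＼ ({b'} : Set α))).erase z) = 5) :
    inCount N 5 e ≤ outCount N 6 e := by
  have ha : a ∈ gr N := h.1
  have ha' : a' ∈ gr N := h.2.1
  have haa' : a ≠ a' := h.2.2.1
  have hind := indep_singleton_of_seriesPair h
  have hgr : gr (N ／ ({a} : Set α)) = (gr N).erase a := gr_contract'
  have hn' : (gr (N ／ ({a} : Set α))).card = 11 := by
    rw [hgr, card_erase_of_mem ha, hn]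
  have hR' : rk (N ／ ({a} : Set α)) (gr (N ／ ({a} : Set α))) = 6 := by
    have := rk_gr_contract_add_one hind ha
    omega
  have hser' : SeriesPair (N ／ ({a} : Set α)) b b' := seriesPair_contract_of_ne h' ha hab hab' hind
  have hn9 := card_gr_minor_add_two_of_seriesPair hser'
  have hR9 := rk_gr_minor_add_one_of_seriesPair hser'
  have hgr9 := gr_minor_of_seriesPair (N := N ／ ({a} : Set α)) b b'
  have he9 : e ∈ gr (((N ／ ({a} : Set α)) ／ ({b} : Set α)) ＼ ({b'} : Set α)) := by
    rw [hgr9, hgr]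
    exact mem_erase.2 ⟨heb', mem_erase.2 ⟨heb, mem_erase.2 ⟨hea, he⟩⟩⟩
  have ha9 : a' ∈ gr (((N ／ ({a} : Set α)) ／ ({b} : Set α)) ＼ ({b'} : Set α)) := by
    rw [hgr9, hgr]
    exact mem_erase.2 ⟨ha'b', mem_erase.2 ⟨ha'b, mem_erase.2 ⟨haa'.symm, ha'⟩⟩⟩
  have h9 := hS (((N ／ ({a} : Set α)) ／ ({b} : Set α)) ＼ ({b'} : Set α)) (by omega) (by omega) hcf9 e he9 a' ha9
    hea'
  exact inCount_five_le_outCount_six_of_two_seriesPairs_of_star_nine hn hR h h' hab hab' ha'b ha'b' hcirc he hea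
    hea' heb heb' h9

end StarNine

end PercRepro.Cogirth
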